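import Summits.BirchSwinnertonDyer.BirchSwinnertonDyer.Theorems.AlignedTransportAtTwoMainConjectureOfRankZeroBSDAtTwoHalfDescentBaseIndexSelmer
import Literature.NumberTheory.EllipticCurves.IwasawaSelmerControlOfLayerKernelsProofs
import HarnessLib

/-!
# Route `AlignedTransportAtTwo`, crux C2 `MainConjectureOfRankZeroBSDAtTwo` (stmt-BirchSwinnertonDyer-22298):
# THE BASE TERM CARRIES `p^μ`, VI — LOCAL CURRENCY AT THE BASE: `#ker g_0 ≤ ∏_{v ∈ S} #𝒦_{v,0}[p^∞]` (Greenberg's Lemma 3.5 argument AT LEVEL `0` ALONE, one prime of `K` above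
# each `v`), hence for EVERY elliptic curve over EVERY number field, every prime `p` and every `ℤ_p`-extension:
# `p^{μ(X(E/K_∞))} ∣ #Sel_{p^∞}(E/K)·#ker g_0 ≤ #Sel_{p^∞}(E/K) · ∏_{v ∣ p or bad} #𝒦_{v,0}[p^∞]` — the kernel form of «`μ ≤ ord_p f_E(0)`» in which Greenberg's Thm. 4.1 is replaced
# by the base divisibility and the local Euler factors by the base local tower kernels; `Sel_{p^∞}(E/K) = 0 ∧ 𝒦_{v,0}[p^∞] = 0 (all v) ⟹ char X(E/K_∞) = Λ`

HONEST FRAMING (cell `bsd-f1-sign2`, WIDTH-5 attached prover seat `bsd-line-att-p5` gen 60 on line `birth` of the lead `bsd-line-att-p2`;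
`--supports` stmt-BirchSwinnertonDyer-22298, closes nothing; BSD is NOT proved by any of this; the crux C2, its verdict «blocked-on
`Rank1Residual.GreenbergMuConjectureIrreducible`» and every registered stub (P / T / Kμ / LimDoor / MuIneqʳ / PFμ⁺) are untouched). THEOREMS ONLY — no `def`,
no instance, no named fact, no `sorry`. Route-independent. Sequel of this gen's `…BaseIndexSelmer` (`p^{μ} ∣ #Sel_{p^∞}(E/K)·#ker g_0`, base door) and of the tree's localisation
step of Greenberg's Lemma 3.5 (`WeierstrassCurve.finite_kerG_and_card_le_of_localKernelBounds`, `IwasawaSelmerControlLocalizationProofs`: `#ker g_n ≤ ∏_{v∈S} C_v^{N_v}` from bounds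
valid at EVERY layer). Here the SAME evaluation-map argument is run with hypotheses AT ONE LAYER (§1), and at the base, where every place of `K` has exactly one prime above it in `K_0 = K`
(`N_v = 1`, `R_v = {1}`), it reads `#ker g_0 ≤ ∏_{v∈S} #𝒦_{v,0}[p^∞]` (§2). This is gen 59's successor (iii) «the kernel `μ ≤ ord₂ f_E(0)`: replace `#ker g_0·#ker g_1` by Greenberg's explicit
local product» — with `#ker g_1` already gone (file III) and `#ker g_0` now bounded by LOCAL data of `E` over the completions of the BASE field only.

THE POINT (`E/K` elliptic over a number field, `p` prime, `κ` ANY `ℤ_p`-extension, `𝒦_{v,n}[p^∞]` = `W.localTowerKerPrimary κ K_v n` = the `p`-power torsion of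
`ker(H¹(K_vK_n, E) → H¹(K_vK_∞, E))`, Greenberg's `ker r_{v_n}`):
* §1 ★ `finite_kerG_and_card_le_of_localKernelBounds_at`: the tree's localisation count with its three hypotheses (vanishing off `S`, bounds `C_v` on `S`, `≤ N_v` double cosets) required
  at the layer `n` in question only: **`#ker g_n ≤ ∏_{v∈S} C_v^{N_v}`**.
* §2 ★★★ `finite_kerG_zero_and_card_le_prod`: **`#ker g_0 ≤ ∏_{v∈S} #𝒦_{v,0}[p^∞]`** for every finite `S` with `𝒦_{v,0}[p^∞] = 0` off `S` and finite on `S`; with `S ⊇ {v ∣ p} ∪ {bad v}`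
  the off-`S` vanishing is the tree's Lemma 3.3 (`localTowerKerPrimary_eq_bot_of_hasGoodReductionAt`) and finiteness at bad `v ∤ p` is the tree's `finite_localTowerKerPrimary_zero_of_not_mem`:
  ★★★ `finite_kerG_zero_and_card_le_prod_of_finite_atP` — only «`𝒦_{v,0}[p^∞]` finite at `v ∣ p`» remains displayed (ordinary/multiplicative `v ∣ p`: Lemma 3.4; FALSE at supersingular `v ∣ p`).
* §3 ★★★ `pow_mu_dvd_and_le_selmer_mul_prod_local`: **`p^{μ(X(E/K_∞))} ∣ #Sel_{p^∞}(E/K)·#ker g_0 ≤ #Sel_{p^∞}(E/K) · ∏_{v∈S} #𝒦_{v,0}[p^∞]`**, so ★★★ `mu_le_log_selmer_mul_prod_local`: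
  **`μ ≤ log_p(#Sel_{p^∞}(E/K) · ∏_{v∈S} #𝒦_{v,0}[p^∞])`** whenever `Sel_{p^∞}(E/K)` is finite; ★★★ THE LOCAL BASE DOOR `charIdeal_eq_top_of_selmer_trivial_of_local`:
  **`#Sel_{p^∞}(E/K) = 1` and `𝒦_{v,0}[p^∞] = 0` for all `v ∈ S` ⟹ `char_Λ X(E/K_∞) = Λ`, `μ = λ = 0`** (Greenberg's «trivial Selmer group and no local obstruction ⟹ trivial
  characteristic ideal», LNM 1716 §4 p. 104 / Thm. 4.1 with `f_E(0) ∈ Λˣ`, here for EVERY `K`, `p`, `κ`, without Thm. 4.1, Cassels–Poitou–Tate or ordinarity).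
* §4 (`K = ℚ`, good ORDINARY `p`, ANY prime `p`, `κ` cyclotomic; the tree's Lemma 3.4 finiteness at level `0`, `finite_localTowerKerPrimary_zero_of_ordinary`)
  ★★★ `mu_le_log_selmer_mul_prod_local_rat`: **`μ(X(E/ℚ_∞)) ≤ log_p(#Sel_{p^∞}(E/ℚ) · ∏_{v ∈ S} #𝒦_{v,0}[p^∞])`** for every `S ⊇ {p} ∪ {bad}` when `Sel_{p^∞}(E/ℚ)` is finite — in print
  `#𝒦_{p,0}[p^∞] = #Ẽ(𝔽_p)[p^∞]²` (L.3.4) and `#𝒦_{ℓ,0}[p^∞] ∣ c_ℓ` (L.3.3): the classical `μ ≤ ord_p(#Ш·∏c_ℓ·#Ẽ(𝔽_p)²)` WITHOUT Greenberg's Euler-characteristic theorem.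
Reading for C2 (`p = 2`, seed cell): `μ₂(W) ≤ v₂(#Ш(W)[2^∞]) + v₂(#𝒦_{2,0}[2^∞]) + Σ_{ℓ ∣ N} v₂(#𝒦_{ℓ,0}[2^∞])`; the door «all three trivial» is shut on the seed cell (`2` is anomalous:
`#Ẽ(𝔽₂) ∈ {2,4}`), the content is the BOUND and its locality. Nothing numerical is asserted; no local kernel is evaluated here; C2 untouched.
Memo `Cruxes/MainConjectureOfRankZeroBSDAtTwo/BASE-TERM-att-p5-g60.md`.

References: R. Greenberg, LNM 1716 (1999), §3 Lemmas 3.1–3.5 (pp. 85–90), §4 Thm. 4.1, Lemmas 4.2–4.4, 4.7 (pp. 102–107) [GreenbergLNM1716]; B. Mazur, Invent. Math. 18 (1972) §6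
[Mazur1972]; J. Coates, R. Sujatha, *Galois cohomology of elliptic curves*, Ch. 3 [CoatesSujatha2000].
-/

set_option linter.dupNamespace false
set_option autoImplicit false

noncomputable section

open scoped Classical Polynomial

universe u

namespace Summit.BirchSwinnertonDyer.BirchSwinnertonDyer.Theorems.AlignedTransportAtTwoHalfDescentBaseIndexLocal

open NumberField IsDedekindDomain WeierstrassCurve Literature.NumberTheory.EllipticCurves Literature.NumberTheory.GaloisRepresentations
  Literature.NumberTheory.EllipticCurves.IwasawaAlgebra
  Summit.BirchSwinnertonDyer.Rank1Residual.X1.MuLambda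
  Summit.BirchSwinnertonDyer.Rank1Residual.Iwasawa
  Summit.BirchSwinnertonDyer.BirchSwinnertonDyer.Theorems.AlignedTransportAtTwoHalfDescentBaseIndexSelmer

variable {K : Type u} [Field K] [NumberField K] (W : WeierstrassCurve K) {p : ℕ} [hp : Fact p.Prime] (κ : ZpExtension K p)
  {γ : Field.absoluteGaloisGroup K}

/-! ## §1 The localisation count at ONE layer -/

section OneLayer

/-- ★ **Greenberg's localisation count at a single layer.** As the tree's `WeierstrassCurve.finite_kerG_and_card_le_of_localKernelBounds` (Greenberg's proof of Lemma 3.5, LNM 1716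
p. 90), but with the three inputs required AT THE LAYER `n` ONLY: (h0) `𝒦_{v,n}[p^∞] = 0` for `v ∉ S`; (hC) `𝒦_{v,n}[p^∞]` finite of order `≤ C_v` for `v ∈ S`; (hN) `≤ N_v` elements
`ρ` with `Γ_K = ⋃_ρ D_v ρ Gal(K̄/K_n)`. Then `ker g_n = A_n/Sel_n` is finite and **`#ker g_n ≤ ∏_{v∈S} C_v^{N_v}`** (evaluation map `y ↦ (loc_v(conj_ρ y))_{v,ρ}` with kernel `⊆ Sel_n`).
[cite: GreenbergLNM1716, §3 Lemma 3.5 (proof, p. 90)] -/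
theorem finite_kerG_and_card_le_of_localKernelBounds_at (n : ℕ) (S : Finset (HeightOneSpectrum (𝓞 K))) (C N : HeightOneSpectrum (𝓞 K) → ℕ)
    (h0 : ∀ v ∉ S, W.localTowerKerPrimary κ (v.adicCompletion K) n = ⊥)
    (hC : ∀ v ∈ S, Finite (W.localTowerKerPrimary κ (v.adicCompletion K) n) ∧ Nat.card (W.localTowerKerPrimary κ (v.adicCompletion K) n) ≤ C v)
    (hN : ∀ v ∈ S, ∃ R : Finset (Field.absoluteGaloisGroup K), R.card ≤ N v ∧
      ∀ σ : Field.absoluteGaloisGroup K, ∃ ρ ∈ R, ∃ δ : Field.absoluteGaloisGroup (v.adicCompletion K), ∃ τ ∈ κ.layerSubgroup n,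
        σ = resGal (K := K) (v.adicCompletion K) δ * ρ * τ) :
    Finite (W.KerG κ n) ∧ Nat.card (W.KerG κ n) ≤ ∏ v ∈ S, C v ^ N v := by
  choose! R hRcard hRcov using hN
  set A := W.selmerInftyPreimage κ n with hA
  set I : Finset ((_ : HeightOneSpectrum (𝓞 K)) × Field.absoluteGaloisGroup K) := S.sigma fun v ↦ R v with hI
  have hIv : ∀ i : ↥I, i.1.1 ∈ S := fun i ↦ (Finset.mem_sigma.mp i.2).1
  let Φ : ↥A →+ (Π i : ↥I, discreteH1 (localSubgroup (κ.layerSubgroup n) (i.1.1.adicCompletion K)) (localPoints W (i.1.1.adicCompletion K))) :=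
    AddMonoidHom.pi fun i ↦ ((W.localResOver p (κ.layerSubgroup n) (i.1.1.adicCompletion K)).comp (W.conjH1 p (κ.layerSubgroup n) i.1.2)).comp A.subtype
  have hΦ : ∀ (y : ↥A) (i : ↥I), Φ y i = W.localResOver p (κ.layerSubgroup n) (i.1.1.adicCompletion K) (W.conjH1 p (κ.layerSubgroup n) i.1.2 (y : W.subgroupH1 p _)) :=
    fun y i ↦ rfl
  -- `ker Φ ⊆ Sel_n`
  have hker : Φ.ker ≤ (W.selmerLayer κ n).addSubgroupOf A := by
    intro y hy
    rw [AddSubgroup.mem_addSubgroupOf]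
    refine W.mem_selmerLayer_of_forall_localResOver_conjH1_eq_zero κ S h0 R (fun v hv σ ↦ hRcov v hv σ) y.2 fun v hv ρ hρ ↦ ?_
    have := congrFun ((AddMonoidHom.mem_ker).mp hy) ⟨⟨v, ρ⟩, Finset.mem_sigma.mpr ⟨hv, hρ⟩⟩
    rw [hΦ] at this
    exact this
  -- the values of `Φ` lie in `∏ 𝒦_{v,n}[p^∞]`
  have hval : ∀ (y : ↥A) (i : ↥I), Φ y i ∈ W.localTowerKerPrimary κ (i.1.1.adicCompletion K) n := by
    intro y i
    obtain ⟨k, hk⟩ := W.exists_pow_smul_subgroupH1_layer_eq_zero κ n (y : W.subgroupH1 p _)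
    rw [hΦ]
    exact ⟨W.localResOver_conjH1_mem_localTowerKer_of_mem κ y.2 _ _, k, by rw [← map_nsmul, ← map_nsmul, hk, map_zero, map_zero]⟩
  haveI hfin : ∀ i : ↥I, Finite (W.localTowerKerPrimary κ (i.1.1.adicCompletion K) n) := fun i ↦ (hC _ (hIv i)).1
  let g : Φ.range → Π i : ↥I, ↥(W.localTowerKerPrimary κ (i.1.1.adicCompletion K) n) :=
    fun x i ↦ ⟨x.1 i, by obtain ⟨y, hy⟩ := x.2; rw [← hy]; exact hval y i⟩
  have hg : Function.Injective g := by
    rintro ⟨x, hx⟩ ⟨x', hx'⟩ h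
    refine Subtype.ext (funext fun i ↦ ?_)
    have := congrFun h i
    simpa [g] using this
  haveI : Finite Φ.range := Finite.of_injective g hg
  have hcard_range : Nat.card Φ.range ≤ ∏ i : ↥I, C i.1.1 :=
    calc Nat.card Φ.range ≤ Nat.card (Π i : ↥I, ↥(W.localTowerKerPrimary κ (i.1.1.adicCompletion K) n)) := Nat.card_le_card_of_injective g hg
      _ = ∏ i : ↥I, Nat.card ↥(W.localTowerKerPrimary κ (i.1.1.adicCompletion K) n) := Nat.card_pi
      _ ≤ ∏ i : ↥I, C i.1.1 := Finset.prod_le_prod (fun i _ ↦ Nat.zero_le _) fun i _ ↦ (hC _ (hIv i)).2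
  -- `A ⧸ ker Φ ↠ A ⧸ Sel_n`
  let π : ↥A ⧸ Φ.ker →+ ↥A ⧸ (W.selmerLayer κ n).addSubgroupOf A :=
    QuotientAddGroup.map Φ.ker ((W.selmerLayer κ n).addSubgroupOf A) (AddMonoidHom.id _) (by rwa [AddSubgroup.comap_id])
  have hπ : Function.Surjective π := by
    intro q
    induction q using QuotientAddGroup.induction_on with
    | H a => exact ⟨QuotientAddGroup.mk a, rfl⟩
  haveI : Finite (↥A ⧸ Φ.ker) := Finite.of_equiv _ (QuotientAddGroup.quotientKerEquivRange Φ).toEquiv.symm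
  have hcard_ker : Nat.card (↥A ⧸ Φ.ker) = Nat.card Φ.range := Nat.card_congr (QuotientAddGroup.quotientKerEquivRange Φ).toEquiv
  have hCpos : ∀ v ∈ S, 1 ≤ C v := fun v hv ↦ by
    haveI := (hC v hv).1
    exact Nat.succ_le_of_lt (lt_of_lt_of_le Nat.card_pos (hC v hv).2)
  refine ⟨Finite.of_surjective π hπ, ?_⟩
  calc Nat.card (↥A ⧸ (W.selmerLayer κ n).addSubgroupOf A)
      ≤ Nat.card (↥A ⧸ Φ.ker) := Nat.card_le_card_of_surjective π hπ
    _ = Nat.card Φ.range := hcard_ker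
    _ ≤ ∏ i : ↥I, C i.1.1 := hcard_range
    _ = ∏ i ∈ I, C i.1 := Finset.prod_coe_sort I (fun i ↦ C i.1)
    _ = ∏ v ∈ S, ∏ ρ ∈ R v, C v := Finset.prod_sigma S (fun v ↦ R v) (fun i ↦ C i.1)
    _ = ∏ v ∈ S, C v ^ (R v).card := Finset.prod_congr rfl fun v _ ↦ Finset.prod_const (C v)
    _ ≤ ∏ v ∈ S, C v ^ N v := Finset.prod_le_prod (fun v _ ↦ Nat.zero_le _) fun v hv ↦ Nat.pow_le_pow_right (hCpos v hv) (hRcard v hv)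

end OneLayer

/-! ## §2 The base: one prime above each place, `#ker g_0 ≤ ∏_{v∈S} #𝒦_{v,0}[p^∞]` -/

section Base

/-- ★★★ **`#ker g_0 ≤ ∏_{v∈S} #𝒦_{v,0}[p^∞]`** — `E/K`, ANY prime `p`, ANY `ℤ_p`-extension `κ`, any finite set `S` of finite places such that the `p`-power torsion `𝒦_{v,0}[p^∞]` of
`ker(H¹(K_v, E) → H¹(K_vK_∞, E))` vanishes for `v ∉ S` and is finite for `v ∈ S`; and `ker g_0 = A_0/Sel_{p^∞}(E/K)` (`A_0 = h_0⁻¹(Sel_{p^∞}(E/K_∞))`) is finite. At the base every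
place has ONE prime above it (`Gal(K̄/K_0) = Γ_K`: `R_v = {1}`). [cite: GreenbergLNM1716, §3 Lemma 3.5 (proof, p. 90) and §4 Lemma 4.4] -/
theorem finite_kerG_zero_and_card_le_prod (S : Finset (HeightOneSpectrum (𝓞 K)))
    (h0 : ∀ v ∉ S, W.localTowerKerPrimary κ (v.adicCompletion K) 0 = ⊥) (hfin : ∀ v ∈ S, Finite (W.localTowerKerPrimary κ (v.adicCompletion K) 0)) :
    Finite (W.KerG κ 0) ∧ Nat.card (W.KerG κ 0) ≤ ∏ v ∈ S, Nat.card (W.localTowerKerPrimary κ (v.adicCompletion K) 0) := by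
  have h := finite_kerG_and_card_le_of_localKernelBounds_at W κ 0 S (fun v ↦ Nat.card (W.localTowerKerPrimary κ (v.adicCompletion K) 0)) (fun _ ↦ 1) h0
    (fun v hv ↦ ⟨hfin v hv, le_rfl⟩) (fun v _ ↦ ⟨{1}, by rw [Finset.card_singleton], fun σ ↦ ⟨1, Finset.mem_singleton_self _, 1, σ, by
      rw [κ.layerSubgroup_zero]; exact Subgroup.mem_top σ, by rw [map_one, one_mul, one_mul]⟩⟩)
  simpa only [pow_one] using h

/-- ★★★ **With `S ⊇ {v ∣ p} ∪ {bad v}` only the places above `p` need an input**: `E/K` elliptic, any `p`, any `ℤ_p`-extension; if `S` contains every place dividing `p` or of bad reduction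
and `𝒦_{v,0}[p^∞]` is finite at the places `v ∣ p` (Lemma 3.4 at the base: true at ordinary and multiplicative `v`, FALSE at supersingular `v`), then `ker g_0` is finite and
**`#ker g_0 ≤ ∏_{v∈S} #𝒦_{v,0}[p^∞]`** (off `S`: Lemma 3.3, tree `localTowerKerPrimary_eq_bot_of_hasGoodReductionAt`; bad `v ∤ p`: tree `finite_localTowerKerPrimary_zero_of_not_mem`).
[cite: GreenbergLNM1716, §3 Lemmas 3.3–3.5 (pp. 86–90)] -/
theorem finite_kerG_zero_and_card_le_prod_of_finite_atP [W.IsElliptic] (S : Finset (HeightOneSpectrum (𝓞 K)))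
    (hS : ∀ v : HeightOneSpectrum (𝓞 K), (p : 𝓞 K) ∈ v.asIdeal ∨ ¬ W.HasGoodReductionAt v → v ∈ S)
    (hfinP : ∀ v ∈ S, (p : 𝓞 K) ∈ v.asIdeal → Finite (W.localTowerKerPrimary κ (v.adicCompletion K) 0)) :
    Finite (W.KerG κ 0) ∧ Nat.card (W.KerG κ 0) ≤ ∏ v ∈ S, Nat.card (W.localTowerKerPrimary κ (v.adicCompletion K) 0) := by
  refine finite_kerG_zero_and_card_le_prod W κ S (fun v hv ↦ ?_) (fun v hv ↦ ?_)
  · have hpv : (p : 𝓞 K) ∉ v.asIdeal := fun h ↦ hv (hS v (Or.inl h))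
    have hgood : W.HasGoodReductionAt v := by
      by_contra h; exact hv (hS v (Or.inr h))
    exact Greenberg1999.localTowerKerPrimary_eq_bot_of_hasGoodReductionAt W κ hpv hgood 0
  · by_cases hpv : (p : 𝓞 K) ∈ v.asIdeal
    · exact hfinP v hv hpv
    · exact W.finite_localTowerKerPrimary_zero_of_not_mem κ hpv

end Base

/-! ## §3 `μ` against the base Selmer group and the base local tower kernels -/

section Mu

/-- ★★★ **`p^{μ(X(E/K_∞))} ∣ #Sel_{p^∞}(E/K)·#ker g_0 ≤ #Sel_{p^∞}(E/K) · ∏_{v∈S} #𝒦_{v,0}[p^∞]`** — `E/K`, ANY `p`, ANY `ℤ_p`-extension with topological generator `γ`, any Pontryagin-dual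
datum with `X` f.g. torsion, any finite `S` off which `𝒦_{v,0}[p^∞] = 0` and on which it is finite; and `0 < #ker g_0`. [cite: GreenbergLNM1716, Conj. 1.11, §3 Lemma 3.5, §4 Thm. 4.1, Lemmas 4.3–4.4] -/
theorem pow_mu_dvd_and_le_selmer_mul_prod_local (hγ : κ.IsTopGenerator γ) (D : W.SelmerDualData κ γ) [Module.Finite (IwasawaAlgebra p) D.X] (hD : D.IsTorsion)
    (S : Finset (HeightOneSpectrum (𝓞 K))) (h0 : ∀ v ∉ S, W.localTowerKerPrimary κ (v.adicCompletion K) 0 = ⊥)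
    (hfin : ∀ v ∈ S, Finite (W.localTowerKerPrimary κ (v.adicCompletion K) 0)) :
    p ^ D.mu ∣ Nat.card ↥(W.selmerLayer κ 0) * Nat.card (W.KerG κ 0) ∧ 0 < Nat.card (W.KerG κ 0) ∧
      Nat.card ↥(W.selmerLayer κ 0) * Nat.card (W.KerG κ 0) ≤ Nat.card ↥(W.selmerLayer κ 0) * ∏ v ∈ S, Nat.card (W.localTowerKerPrimary κ (v.adicCompletion K) 0) := by
  obtain ⟨hfinG, hle⟩ := finite_kerG_zero_and_card_le_prod W κ S h0 hfin
  haveI := hfinG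
  exact ⟨pow_mu_dvd_natCard_selmerLayer_zero_mul_kerG_zero W κ hγ D hD, Nat.card_pos, Nat.mul_le_mul_left _ hle⟩

/-- ★★★ **`μ(X(E/K_∞)) ≤ log_p(#Sel_{p^∞}(E/K) · ∏_{v∈S} #𝒦_{v,0}[p^∞])`** whenever `Sel_{p^∞}(E/K)` is finite — `E/K`, any `p`, any `ℤ_p`-extension, any dual datum with `X` f.g. torsion, any
admissible `S`: the `μ`-invariant is bounded by the base Selmer group and finitely many LOCAL tower kernels at the base. [cite: GreenbergLNM1716, Conj. 1.11, §4 Thm. 4.1 and Lemma 4.4] -/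
theorem mu_le_log_selmer_mul_prod_local (hγ : κ.IsTopGenerator γ) (D : W.SelmerDualData κ γ) [Module.Finite (IwasawaAlgebra p) D.X] (hD : D.IsTorsion)
    (S : Finset (HeightOneSpectrum (𝓞 K))) (h0 : ∀ v ∉ S, W.localTowerKerPrimary κ (v.adicCompletion K) 0 = ⊥)
    (hfin : ∀ v ∈ S, Finite (W.localTowerKerPrimary κ (v.adicCompletion K) 0)) [Finite ↥(W.selmerLayer κ 0)] :
    p ^ D.mu ≤ Nat.card ↥(W.selmerLayer κ 0) * ∏ v ∈ S, Nat.card (W.localTowerKerPrimary κ (v.adicCompletion K) 0) ∧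
      D.mu ≤ Nat.log p (Nat.card ↥(W.selmerLayer κ 0) * ∏ v ∈ S, Nat.card (W.localTowerKerPrimary κ (v.adicCompletion K) 0)) := by
  obtain ⟨hdvd, hpos, hle⟩ := pow_mu_dvd_and_le_selmer_mul_prod_local W κ hγ D hD S h0 hfin
  have h1 : p ^ D.mu ≤ Nat.card ↥(W.selmerLayer κ 0) * ∏ v ∈ S, Nat.card (W.localTowerKerPrimary κ (v.adicCompletion K) 0) :=
    (Nat.le_of_dvd (Nat.mul_pos Nat.card_pos hpos) hdvd).trans hle
  exact ⟨h1, Nat.le_log_of_pow_le hp.out.one_lt h1⟩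

/-- ★★★ **THE LOCAL BASE DOOR: `Sel_{p^∞}(E/K)` trivial and `𝒦_{v,0}[p^∞] = 0` at every `v ∈ S` (and off `S`) ⟹ `char_Λ X(E/K_∞) = Λ`, `μ = 0`, `λ = 0`.** `E/K`, any `p`, any
`ℤ_p`-extension, any dual datum with `X` f.g. torsion. Greenberg's «`Sel_E(K)_p = 0` and no local obstruction ⟹ trivial characteristic ideal» (LNM 1716 §4, p. 104, there from Thm. 4.1 at
ordinary `p`) — here for every `K`, `p`, `κ`, from the base divisibility, with no Euler-characteristic theorem. [cite: GreenbergLNM1716, §4 Thm. 4.1 and p. 104] -/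
theorem charIdeal_eq_top_of_selmer_trivial_of_local (hγ : κ.IsTopGenerator γ) (D : W.SelmerDualData κ γ) [Module.Finite (IwasawaAlgebra p) D.X] (hD : D.IsTorsion)
    (S : Finset (HeightOneSpectrum (𝓞 K))) (h0 : ∀ v ∉ S, W.localTowerKerPrimary κ (v.adicCompletion K) 0 = ⊥)
    (hS0 : ∀ v ∈ S, W.localTowerKerPrimary κ (v.adicCompletion K) 0 = ⊥) (hSel : Nat.card ↥(W.selmerLayer κ 0) = 1) :
    D.charIdeal = ⊤ ∧ D.mu = 0 ∧ D.lambda = 0 := by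
  have hfin : ∀ v ∈ S, Finite (W.localTowerKerPrimary κ (v.adicCompletion K) 0) := fun v hv ↦ by rw [hS0 v hv]; infer_instance
  obtain ⟨hfinG, hle⟩ := finite_kerG_zero_and_card_le_prod W κ S h0 hfin
  haveI := hfinG
  have hprod : ∏ v ∈ S, Nat.card (W.localTowerKerPrimary κ (v.adicCompletion K) 0) = 1 :=
    Finset.prod_eq_one fun v hv ↦ by rw [hS0 v hv, AddSubgroup.card_bot]
  have hG : Nat.card (W.KerG κ 0) = 1 := le_antisymm (hprod ▸ hle) Nat.card_pos
  refine charIdeal_eq_top_of_not_dvd W κ hγ D hD ?_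
  rw [hSel, hG, mul_one]
  exact hp.out.not_dvd_one

end Mu

/-! ## §4 `K = ℚ`, good ordinary `p` (any prime): the base local kernels are finite, `μ ≤ log_p(#Sel_{p^∞}(E/ℚ)·∏_{v∈S} #𝒦_{v,0}[p^∞])` -/

section Rat

variable (W : WeierstrassCurve ℚ) [W.IsElliptic] {p : ℕ} [hp : Fact p.Prime] (κ : ZpExtension ℚ p) {γ : Field.absoluteGaloisGroup ℚ}

/-- ★★★ **Over `ℚ` at a good ORDINARY prime `p` (ANY `p`), `κ` cyclotomic with topological generator `γ`, `W` globally minimal, any torsion dual datum, any finite `S` containing the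
place `p` and the bad places: `ker g_0` is finite, `#ker g_0 ≤ ∏_{v∈S} #𝒦_{v,0}[p^∞]`, `p^{μ} ∣ #Sel_{p^∞}(W/ℚ)·#ker g_0`, and — when `Sel_{p^∞}(W/ℚ)` is finite —
`μ(X(W/ℚ_∞)) ≤ log_p(#Sel_{p^∞}(W/ℚ) · ∏_{v∈S} #𝒦_{v,0}[p^∞])`.** The finiteness at `p` is the tree's Lemma 3.4 at the base (`finite_localTowerKerPrimary_zero_of_ordinary`); in print
`#𝒦_{p,0}[p^∞] = #W̃(𝔽_p)[p^∞]²` and `#𝒦_{ℓ,0}[p^∞] ∣ c_ℓ`, so this is `μ ≤ ord_p(#Sel_{p^∞}(W/ℚ)·#W̃(𝔽_p)[p^∞]²·∏c_ℓ)` — Greenberg's `μ ≤ ord_p f_E(0)` read through Thm. 4.1, here WITHOUT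
Thm. 4.1. [cite: GreenbergLNM1716, §3 Lemmas 3.3–3.5, §4 Thm. 4.1, Lemma 4.4 (pp. 102–105)] -/
theorem finite_kerG_zero_and_mu_le_rat [W.IsGloballyMinimal] (hgood : W.HasGoodReductionAtPrime p) (hord : ¬ (p : ℤ) ∣ W.frobeniusTrace p) (hκ : κ.IsCyclotomic)
    (hγ : κ.IsTopGenerator γ) (D : W.SelmerDualData κ γ) (hD : D.IsTorsion) (S : Finset (HeightOneSpectrum (𝓞 ℚ)))
    (hS : ∀ v : HeightOneSpectrum (𝓞 ℚ), (p : 𝓞 ℚ) ∈ v.asIdeal ∨ ¬ W.HasGoodReductionAt v → v ∈ S) :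
    Finite (W.KerG κ 0) ∧ Nat.card (W.KerG κ 0) ≤ ∏ v ∈ S, Nat.card (W.localTowerKerPrimary κ (v.adicCompletion ℚ) 0) ∧
      p ^ D.mu ∣ Nat.card ↥(W.selmerLayer κ 0) * Nat.card (W.KerG κ 0) ∧
      (Finite ↥(W.selmerLayer κ 0) → D.mu ≤ Nat.log p (Nat.card ↥(W.selmerLayer κ 0) * ∏ v ∈ S, Nat.card (W.localTowerKerPrimary κ (v.adicCompletion ℚ) 0))) := by
  haveI : Module.Finite (IwasawaAlgebra p) D.X := D.module_finite_holds hγ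
  have hΔ : ¬ (p : ℤ) ∣ minimalDiscriminantInt W := W.not_dvd_minimalDiscriminantInt_of_hasGoodReductionAtPrime' p hgood
  have hfinP : ∀ v ∈ S, (p : 𝓞 ℚ) ∈ v.asIdeal → Finite (W.localTowerKerPrimary κ (v.adicCompletion ℚ) 0) :=
    fun v _ hpv ↦ W.finite_localTowerKerPrimary_zero_of_ordinary hpv hΔ hord κ hκ
  obtain ⟨hfinG, hle⟩ := finite_kerG_zero_and_card_le_prod_of_finite_atP W κ S hS hfinP
  haveI := hfinG
  have hdvd := pow_mu_dvd_natCard_selmerLayer_zero_mul_kerG_zero W κ hγ D hD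
  refine ⟨hfinG, hle, hdvd, fun hSel ↦ ?_⟩
  haveI := hSel
  have h1 : p ^ D.mu ≤ Nat.card ↥(W.selmerLayer κ 0) * ∏ v ∈ S, Nat.card (W.localTowerKerPrimary κ (v.adicCompletion ℚ) 0) :=
    (Nat.le_of_dvd (Nat.mul_pos Nat.card_pos Nat.card_pos) hdvd).trans (Nat.mul_le_mul_left _ hle)
  exact Nat.le_log_of_pow_le hp.out.one_lt h1

end Rat

end Summit.BirchSwinnertonDyer.BirchSwinnertonDyer.Theorems.AlignedTransportAtTwoHalfDescentBaseIndexLocal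

end
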